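import Summits.FinalStateConjecture.FinalStateConjecture.Theorems.SwallowTheDatumSubdataDevelopmentsEmbedDoDCausal
import Literature.Geometry.Lorentzian.CausalityPushUp

/-!
# Route SwallowTheDatum · item `SubdataDevelopmentsEmbed` (stmt-FinalStateConjecture-10053) —
# towards the domain of dependence of the sub-datum (`hcauchy`), VI: one-sided bounds near a
# point of a Cauchy hypersurface with a tangency estimate

Preparations for the local domain-of-dependence lemma (`…DoDMain.lean`). Fix a Cauchy
hypersurface `Σ`, a point `p ∈ Σ`, a future timelike vector `W ∈ T_p M`, the chart `φ` at `p`,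
`x₀ = φ p`, the coordinate image `Ŵ` of `W`, the coordinate metric `Ĝ` and the covector
`m = Ĝ_{x₀}(Ŵ, ·)` (so that `-m` is positive on future causal coordinate velocities near `x₀`).
The TANGENCY HYPOTHESIS `hT` says that `Σ` is tangent at `p` to the kernel of `m` in the chart:
`|m(φ q - x₀)| ≤ ε ‖φ q - x₀‖` for `q ∈ Σ` close to `p`, for every `ε > 0` (for the image of a
spacelike data embedding with `W` the unit normal this is proved in `…DoDTangent.lean`).

* `Icc_induction_down`, `Icc_induction_up` — "continuous induction" on a compact interval.
* `isFutureTimelikeCurveOn_line` — straight coordinate lines `s ↦ φ⁻¹(z₁ + s Ŵ)` near `x₀` are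
  future timelike.
* `exists_osb` — ONE-SIDED BOUNDS: for every `ε > 0` there is `ρ₀ > 0` such that for `ρ ≤ ρ₀`
  and `q` in the chart domain with `‖φ q - x₀‖ < ρ`: if `q ∉ I⁻(Σ)` then `m(φ q - x₀) ≤ ε ρ`, and
  if `q ∉ I⁺(Σ)` then `m(φ q - x₀) ≥ -ε ρ`. Proof: the straight line from `q` in direction `-Ŵ`
  (resp. `+Ŵ`) of coordinate length `l₀` ends in `I⁻(Σ)` (resp. `I⁺(Σ)`) — it ends near
  `φ⁻¹(x₀ ∓ l₀ Ŵ)`, which is chronologically related to `p ∈ Σ` by a straight line, and `I∓(Σ)`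
  is open — so by the separation lemma (`exists_mem_of_isFutureTimelikeCurveOn`,
  `…DoDCausal.lean`) it meets `Σ`, where the tangency estimate applies; since `m(Ŵ) = g(W, W) < 0`
  the displacement along the line only helps.

O'Neill 1983, Ch. 14, Lemma 14.29 (trichotomy `I⁻(Σ) ⊔ Σ ⊔ I⁺(Σ)`), Ch. 5, Lemma 5.26 ff.
(timelike cones), and the elementary geometry of a spacelike hypersurface in normal-adapted
coordinates (O'Neill 1983, Ch. 14, Lemma 14.43 uses the same picture). No definition, no named
fact.
-/

noncomputable section

open Function Set Filter Topology TopologicalSpace Bundle Manifold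
open scoped Manifold ContDiff Topology

namespace Summit.FinalStateConjecture.FinalStateConjecture.Theorems

namespace SubdataDevelopmentsEmbed

open Literature.Geometry.Lorentzian

section Induction

/-- **Continuous induction, downwards.** If `P` holds at `b`, is an open condition on `[a, b]`,
and passes to the left end of every half-open interval `(t, b]` on which it holds, then `P` holds
on `[a, b]` (consider the supremum of the parameters where `P` fails). -/
theorem Icc_induction_down {a b : ℝ} {P : ℝ → Prop}
    (hopen : ∀ r ∈ Icc a b, P r → ∀ᶠ r' in 𝓝 r, P r') (hb : P b)
    (hstep : ∀ t ∈ Ico a b, (∀ r ∈ Ioc t b, P r) → P t) : ∀ r ∈ Icc a b, P r := by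
  by_contra hcon
  push Not at hcon
  obtain ⟨r₀, hr₀, hPr₀⟩ := hcon
  set B : Set ℝ := {r | r ∈ Icc a b ∧ ¬ P r} with hB
  have hr₀B : r₀ ∈ B := ⟨hr₀, hPr₀⟩
  have hBne : B.Nonempty := ⟨r₀, hr₀B⟩
  have hBbdd : BddAbove B := ⟨b, fun r hr ↦ hr.1.2⟩
  set β : ℝ := sSup B with hβ
  have hβb : β ≤ b := csSup_le hBne fun r hr ↦ hr.1.2
  have haβ : a ≤ β := hr₀.1.trans (le_csSup hBbdd hr₀B)
  have hPβ : P β := by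
    rcases eq_or_lt_of_le hβb with h | h
    · rw [h]; exact hb
    · refine hstep β ⟨haβ, h⟩ fun r hr ↦ ?_
      by_contra hnr
      have : r ≤ β := le_csSup hBbdd ⟨⟨haβ.trans hr.1.le, hr.2⟩, hnr⟩
      exact absurd hr.1 (not_lt.mpr this)
  obtain ⟨η, hη, hηP⟩ := Metric.eventually_nhds_iff.mp (hopen β ⟨haβ, hβb⟩ hPβ)
  have hle : β ≤ β - η := by
    refine csSup_le hBne fun r hr ↦ ?_
    by_contra hlt
    push Not at hlt
    have hrβ : r ≤ β := le_csSup hBbdd hr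
    refine hr.2 (hηP ?_)
    rw [Real.dist_eq, abs_sub_lt_iff]
    constructor <;> linarith
  linarith

/-- **Continuous induction, upwards** (mirror image of `Icc_induction_down`). -/
theorem Icc_induction_up {a b : ℝ} {P : ℝ → Prop}
    (hopen : ∀ r ∈ Icc a b, P r → ∀ᶠ r' in 𝓝 r, P r') (ha : P a)
    (hstep : ∀ t ∈ Ioc a b, (∀ r ∈ Ico a t, P r) → P t) : ∀ r ∈ Icc a b, P r := by
  by_contra hcon
  push Not at hcon
  obtain ⟨r₀, hr₀, hPr₀⟩ := hcon
  set B : Set ℝ := {r | r ∈ Icc a b ∧ ¬ P r} with hB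
  have hr₀B : r₀ ∈ B := ⟨hr₀, hPr₀⟩
  have hBne : B.Nonempty := ⟨r₀, hr₀B⟩
  have hBbdd : BddBelow B := ⟨a, fun r hr ↦ hr.1.1⟩
  set β : ℝ := sInf B with hβ
  have haβ : a ≤ β := le_csInf hBne fun r hr ↦ hr.1.1
  have hβb : β ≤ b := (csInf_le hBbdd hr₀B).trans hr₀.2
  have hPβ : P β := by
    rcases eq_or_lt_of_le haβ with h | h
    · rw [← h]; exact ha
    · refine hstep β ⟨h, hβb⟩ fun r hr ↦ ?_
      by_contra hnr
      have : β ≤ r := csInf_le hBbdd ⟨⟨hr.1, hr.2.le.trans hβb⟩, hnr⟩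
      exact absurd hr.2 (not_lt.mpr this)
  obtain ⟨η, hη, hηP⟩ := Metric.eventually_nhds_iff.mp (hopen β ⟨haβ, hβb⟩ hPβ)
  have hle : β + η ≤ β := by
    refine le_csInf hBne fun r hr ↦ ?_
    by_contra hlt
    push Not at hlt
    have hrβ : β ≤ r := csInf_le hBbdd hr
    refine hr.2 (hηP ?_)
    rw [Real.dist_eq, abs_sub_lt_iff]
    constructor <;> linarith
  linarith

end Induction

section OneSided

variable {E : Type*} [NormedAddCommGroup E] [NormedSpace ℝ E] {H : Type*} [TopologicalSpace H]
  {I : ModelWithCorners ℝ E H} {n : ℕ∞ω} {M : Type*} [TopologicalSpace M] [ChartedSpace H M]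
  [IsManifold I ∞ M] {g : LorentzianMetric I n M} {τ : TimeOrientation g}
  [T2Space M] [SecondCountableTopology M] [BoundarylessManifold I M] [FiniteDimensional ℝ E]

omit [T2Space M] [SecondCountableTopology M] [BoundarylessManifold I M] [FiniteDimensional ℝ E] in
/-- **Straight coordinate lines in a future timelike coordinate direction are future timelike.**
If on the coordinate ball `‖z - φ p‖ < δ` (contained in the chart target) the constant field
`Ŵ` satisfies `Ĝ(Ŵ, Ŵ) < 0` and `Ĝ(T̂, Ŵ) < 0`, then every line `s ↦ φ⁻¹(z₁ + s Ŵ)` staying in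
that ball is a future timelike curve. O'Neill 1983, Ch. 5, Lemma 5.26 ff. in coordinates
(`isFutureTimelikeCurveOn_extChartAt_symm_comp`). -/
theorem isFutureTimelikeCurveOn_line {p : M} {W₀ : E} {δ : ℝ}
    (hδ : ∀ z : E, ‖z - extChartAt I p p‖ < δ → z ∈ (extChartAt I p).target ∧
      g.coordMetric p z W₀ W₀ < 0 ∧ g.coordMetric p z (τ.coordTime p z) W₀ < 0)
    {z₁ : E} {Λ : ℝ} (hin : ∀ s ∈ Icc (0 : ℝ) Λ, ‖z₁ + s • W₀ - extChartAt I p p‖ < δ) :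
    g.IsFutureTimelikeCurveOn τ ((extChartAt I p).symm ∘ fun s ↦ z₁ + s • W₀) (Icc 0 Λ) := by
  refine isFutureTimelikeCurveOn_extChartAt_symm_comp (U := Metric.ball (extChartAt I p p) δ)
    Metric.isOpen_ball (fun z hz ↦ (hδ z (by rwa [Metric.mem_ball, dist_eq_norm] at hz)).1)
    fun s hs ↦ ⟨?_, ?_, (hδ _ (hin s hs)).2.1, (hδ _ (hin s hs)).2.2⟩
  · have h := ((hasDerivAt_id s).smul_const W₀).const_add z₁
    simpa using h
  · rw [Metric.mem_ball, dist_eq_norm]; exact hin s hs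

/-- **One-sided bounds near a point of a Cauchy hypersurface with a tangency estimate** (see
the module docstring for the notation `φ, x₀, Ŵ, Ĝ, m`). For every `ε > 0` there is `ρ₀ > 0` such
that for all `ρ ≤ ρ₀` and all `q` in the chart domain with `‖φ q - x₀‖ < ρ`:
`q ∉ I⁻(Σ) ⟹ m(φ q - x₀) ≤ ε ρ` and `q ∉ I⁺(Σ) ⟹ -ε ρ ≤ m(φ q - x₀)`. -/
theorem exists_osb (hn : 2 ≤ n) {Sig : Set M} (hSig : g.IsCauchyHypersurface τ Sig) {p : M}
    (hp : p ∈ Sig) {W : TangentSpace I p} (hW : g.IsTimelike W) (hWf : τ.IsFutureDirected W)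
    (hT : ∀ ε : ℝ, 0 < ε → ∃ δ > 0, ∀ q ∈ Sig, q ∈ (chartAt H p).source →
      ‖extChartAt I p q - extChartAt I p p‖ < δ →
      |g.coordMetric p (extChartAt I p p)
          ((trivializationAt E (TangentSpace I) p).continuousLinearMapAt ℝ p W)
          (extChartAt I p q - extChartAt I p p)| ≤ ε * ‖extChartAt I p q - extChartAt I p p‖)
    {ε : ℝ} (hε : 0 < ε) :
    ∃ ρ₀ > 0, ∀ ρ : ℝ, ρ ≤ ρ₀ → ∀ q ∈ (chartAt H p).source,
      ‖extChartAt I p q - extChartAt I p p‖ < ρ →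
      (q ∉ g.chronologicalPast τ Sig →
        g.coordMetric p (extChartAt I p p)
          ((trivializationAt E (TangentSpace I) p).continuousLinearMapAt ℝ p W)
          (extChartAt I p q - extChartAt I p p) ≤ ε * ρ) ∧
      (q ∉ g.chronologicalFuture τ Sig →
        -(ε * ρ) ≤ g.coordMetric p (extChartAt I p p)
          ((trivializationAt E (TangentSpace I) p).continuousLinearMapAt ℝ p W)
          (extChartAt I p q - extChartAt I p p)) := by
  have hn1 : (1 : ℕ∞ω) ≤ n := le_trans one_le_two hn
  -- the chart at `p`
  set x₀ : E := extChartAt I p p with hx₀def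
  have hx₀t : x₀ ∈ (extChartAt I p).target :=
    (extChartAt I p).map_source (mem_extChartAt_source p)
  have hx₀p : (extChartAt I p).symm x₀ = p := (extChartAt I p).left_inv (mem_extChartAt_source p)
  have htarget : (extChartAt I p).target ∈ 𝓝 x₀ := by
    have hint : x₀ ∈ interior (extChartAt I p).target :=
      ModelWithCorners.isInteriorPoint_iff.mp (BoundarylessManifold.isInteriorPoint (I := I))
    exact mem_interior_iff_mem_nhds.mp hint
  set eT := trivializationAt E (TangentSpace I) p with heT
  set W₀ : E := eT.continuousLinearMapAt ℝ p W with hW₀def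
  set m : E →L[ℝ] ℝ := g.coordMetric p x₀ W₀ with hmdef
  have hGcd : ContDiffOn ℝ 1 (g.coordMetric p) (extChartAt I p).target :=
    g.contDiffOn_coordMetric hn1 p
  have hGc : ContinuousAt (g.coordMetric p) x₀ := (hGcd.continuousOn x₀ hx₀t).continuousAt htarget
  have hGTc : ContinuousAt (fun x ↦ g.coordMetric p x (τ.coordTime p x)) x₀ :=
    ((hGcd.continuousOn.clm_apply (τ.continuousOn_coordTime hn1 p)) x₀ hx₀t).continuousAt htarget
  have hpb : p ∈ eT.baseSet := by simp [heT]
  have hsymmW₀ : eT.symmL ℝ ((extChartAt I p).symm x₀) W₀ = W := by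
    have h : eT.symmL ℝ p W₀ = W := by
      rw [hW₀def]
      exact eT.symmL_continuousLinearMapAt hpb W
    have hgen : ∀ q, q = p → eT.symmL ℝ q W₀ = (W : E) := by
      rintro q rfl; exact h
    exact hgen _ hx₀p
  have hW₀W₀ : g.coordMetric p x₀ W₀ W₀ < 0 := by
    rw [g.coordMetric_apply hx₀t W₀ W₀, hsymmW₀, hx₀p]
    exact hW
  have hTW₀ : g.coordMetric p x₀ (τ.coordTime p x₀) W₀ < 0 := by
    rw [coordMetric_coordTime_apply hx₀t, hsymmW₀, hx₀p]
    exact hWf.2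
  -- `a = -Ĝ(Ŵ, Ŵ) > 0`
  have hmW : m W₀ < 0 := hW₀W₀
  set a : ℝ := -(m W₀) with hadef
  have ha : 0 < a := by rw [hadef]; linarith
  -- radius `δ₁`: target, `Ŵ` future timelike
  obtain ⟨δ₁, hδ₁, hδ₁'⟩ : ∃ δ > 0, ∀ z : E, ‖z - x₀‖ < δ → z ∈ (extChartAt I p).target ∧
      g.coordMetric p z W₀ W₀ < 0 ∧ g.coordMetric p z (τ.coordTime p z) W₀ < 0 := by
    have h1 : ∀ᶠ z in 𝓝 x₀, z ∈ (extChartAt I p).target := htarget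
    have h4 : ∀ᶠ z in 𝓝 x₀, g.coordMetric p z W₀ W₀ < 0 := by
      have hcts : ContinuousAt (fun z ↦ g.coordMetric p z W₀ W₀) x₀ :=
        (hGc.clm_apply continuousAt_const).clm_apply continuousAt_const
      exact hcts.preimage_mem_nhds (Iio_mem_nhds hW₀W₀)
    have h5 : ∀ᶠ z in 𝓝 x₀, g.coordMetric p z (τ.coordTime p z) W₀ < 0 := by
      have hcts : ContinuousAt (fun z ↦ g.coordMetric p z (τ.coordTime p z) W₀) x₀ :=
        hGTc.clm_apply continuousAt_const
      exact hcts.preimage_mem_nhds (Iio_mem_nhds hTW₀)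
    obtain ⟨δ, hδ, h⟩ := Metric.eventually_nhds_iff.mp (h1.and (h4.and h5))
    exact ⟨δ, hδ, fun z hz ↦ h (by rwa [dist_eq_norm])⟩
  -- the tangency estimate at scale `ε₁ ≤ ε`, `ε₁ ‖Ŵ‖ ≤ a`
  set ε₁ : ℝ := min ε (a / (‖W₀‖ + 1)) with hε₁def
  have hε₁ : 0 < ε₁ := lt_min hε (by positivity)
  have hε₁ε : ε₁ ≤ ε := min_le_left _ _
  have hε₁W : ε₁ * ‖W₀‖ ≤ a := by
    have h1 : ε₁ ≤ a / (‖W₀‖ + 1) := min_le_right _ _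
    have h2 : a / (‖W₀‖ + 1) * ‖W₀‖ ≤ a := by
      rw [div_mul_eq_mul_div, div_le_iff₀ (by positivity)]
      nlinarith [norm_nonneg W₀, ha.le]
    exact (mul_le_mul_of_nonneg_right h1 (norm_nonneg _)).trans h2
  obtain ⟨δT, hδT, hT'⟩ := hT ε₁ hε₁
  -- the scale `R` and the coordinate length `l₀` of the lines
  set R : ℝ := min δ₁ δT with hRdef
  have hR : 0 < R := lt_min hδ₁ hδT
  set l₀ : ℝ := R / (4 * (‖W₀‖ + 1)) with hl₀def
  have hl₀ : 0 < l₀ := by positivity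
  have hl₀W : l₀ * ‖W₀‖ ≤ R / 4 := by
    rw [hl₀def, div_mul_eq_mul_div, div_le_iff₀ (by positivity)]
    nlinarith [norm_nonneg W₀, hR.le]
  -- straight lines within `R` of `x₀` are future timelike
  have hline : ∀ (z₁ : E) (Λ : ℝ), (∀ s ∈ Icc (0 : ℝ) Λ, ‖z₁ + s • W₀ - x₀‖ < R) →
      g.IsFutureTimelikeCurveOn τ ((extChartAt I p).symm ∘ fun s ↦ z₁ + s • W₀) (Icc 0 Λ) :=
    fun z₁ Λ h ↦ isFutureTimelikeCurveOn_line hδ₁' fun s hs ↦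
      lt_of_lt_of_le (h s hs) (min_le_left _ _)
  -- the reference points `q± = φ⁻¹(x₀ ± l₀ Ŵ)` lie in `I±(Σ)`
  have hsl : ∀ s ∈ Icc (0 : ℝ) l₀, ‖s • W₀‖ < R := fun s hs ↦ by
    rw [norm_smul, Real.norm_of_nonneg hs.1]
    calc s * ‖W₀‖ ≤ l₀ * ‖W₀‖ := mul_le_mul_of_nonneg_right hs.2 (norm_nonneg _)
      _ ≤ R / 4 := hl₀W
      _ < R := by linarith
  have hqf : (extChartAt I p).symm (x₀ + l₀ • W₀) ∈ g.chronologicalFuture τ Sig := by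
    refine ⟨p, hp, (extChartAt I p).symm ∘ fun s ↦ x₀ + s • W₀, 0, l₀, hl₀, hline x₀ l₀ ?_, ?_,
      rfl⟩
    · intro s hs
      rw [add_sub_cancel_left]
      exact hsl s hs
    · simp only [comp_apply, zero_smul, add_zero]
      exact hx₀p
  have hqp : (extChartAt I p).symm (x₀ - l₀ • W₀) ∈ g.chronologicalPast τ Sig := by
    have h1 : p ∈ g.chronologicalFuture τ {(extChartAt I p).symm (x₀ - l₀ • W₀)} := by
      refine ⟨_, rfl, (extChartAt I p).symm ∘ fun s ↦ (x₀ - l₀ • W₀) + s • W₀, 0, l₀, hl₀,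
        hline _ l₀ ?_, ?_, ?_⟩
      · intro s hs
        have : x₀ - l₀ • W₀ + s • W₀ - x₀ = -((l₀ - s) • W₀) := by rw [sub_smul]; abel
        rw [this, norm_neg]
        exact hsl (l₀ - s) ⟨by linarith [hs.2], by linarith [hs.1]⟩
      · simp only [comp_apply, zero_smul, add_zero]
      · simp only [comp_apply, sub_add_cancel]
        exact hx₀p
    exact LorentzianMetric.chronologicalFuture_mono (τ := τ.reverse) (singleton_subset_iff.2 hp)
      (LorentzianMetric.mem_chronologicalPast_of_mem_chronologicalFuture h1)
  -- balls around `x₀ ± l₀ Ŵ` mapped into the open sets `I±(Σ)`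
  have hpm : ∀ (z₁ : E) (U : Set M), IsOpen U → ‖z₁ - x₀‖ < R →
      (extChartAt I p).symm z₁ ∈ U →
      ∃ r > 0, ∀ z : E, ‖z - z₁‖ < r → (extChartAt I p).symm z ∈ U := by
    intro z₁ U hU hz₁ hmem
    have hz₁t : z₁ ∈ (extChartAt I p).target :=
      (hδ₁' z₁ (lt_of_lt_of_le hz₁ (min_le_left _ _))).1
    have := (continuousAt_extChartAt_symm'' hz₁t).preimage_mem_nhds (hU.mem_nhds hmem)
    obtain ⟨r, hr, h⟩ := Metric.mem_nhds_iff.mp this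
    exact ⟨r, hr, fun z hz ↦ h (by rwa [Metric.mem_ball, dist_eq_norm])⟩
  have hnf : ‖x₀ + l₀ • W₀ - x₀‖ < R := by
    rw [add_sub_cancel_left]; exact hsl l₀ ⟨hl₀.le, le_rfl⟩
  have hnb : ‖x₀ - l₀ • W₀ - x₀‖ < R := by
    rw [sub_sub_cancel_left, norm_neg]; exact hsl l₀ ⟨hl₀.le, le_rfl⟩
  obtain ⟨ρf, hρf, hρf'⟩ :=
    hpm _ _ (LorentzianMetric.isOpen_chronologicalFuture_of_boundaryless g τ Sig) hnf hqf
  obtain ⟨ρb, hρb, hρb'⟩ :=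
    hpm _ _ (LorentzianMetric.isOpen_chronologicalPast_of_boundaryless g τ Sig) hnb hqp
  -- the radius `ρ₀`
  set ρ₀ : ℝ := min (min ρf ρb) (R / 4) with hρ₀def
  have hρ₀ : 0 < ρ₀ := lt_min (lt_min hρf hρb) (by positivity)
  refine ⟨ρ₀, hρ₀, fun ρ hρ q hq hqρ ↦ ?_⟩
  have hρfle : ρ ≤ ρf := hρ.trans ((min_le_left _ _).trans (min_le_left _ _))
  have hρble : ρ ≤ ρb := hρ.trans ((min_le_left _ _).trans (min_le_right _ _))
  have hρR : ρ ≤ R / 4 := hρ.trans (min_le_right _ _)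
  set z : E := extChartAt I p q with hzdef
  have hρ0 : 0 ≤ ρ := (norm_nonneg _).trans hqρ.le
  have hq' : q ∈ (extChartAt I p).source := by rwa [extChartAt_source]
  have hqz : (extChartAt I p).symm z = q := (extChartAt I p).left_inv hq'
  -- points on the lines through `z` are within `R` of `x₀`
  have hzs : ∀ s : ℝ, |s| ≤ l₀ → ‖z + s • W₀ - x₀‖ < R := by
    intro s hs
    have h1 : ‖s • W₀‖ ≤ R / 4 := by
      rw [norm_smul, Real.norm_eq_abs]
      exact (mul_le_mul_of_nonneg_right hs (norm_nonneg _)).trans hl₀W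
    calc ‖z + s • W₀ - x₀‖ = ‖(z - x₀) + s • W₀‖ := by abel_nf
      _ ≤ ‖z - x₀‖ + ‖s • W₀‖ := norm_add_le _ _
      _ < R / 4 + R / 4 := add_lt_add_of_lt_of_le (lt_of_lt_of_le hqρ hρR) h1
      _ ≤ R := by linarith
  -- the tangency estimate at a point of `Σ` on such a line
  have hTz : ∀ s : ℝ, |s| ≤ l₀ → (extChartAt I p).symm (z + s • W₀) ∈ Sig →
      |m (z - x₀) + s * m W₀| ≤ ε₁ * (‖z - x₀‖ + |s| * ‖W₀‖) := by
    intro s hs hmem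
    have hR' := hzs s hs
    have hζt : z + s • W₀ ∈ (extChartAt I p).target :=
      (hδ₁' _ (lt_of_lt_of_le hR' (min_le_left _ _))).1
    have hsrc : (extChartAt I p).symm (z + s • W₀) ∈ (chartAt H p).source := by
      rw [← extChartAt_source I]
      exact (extChartAt I p).map_target hζt
    have h := hT' _ hmem hsrc
    rw [(extChartAt I p).right_inv hζt] at h
    have h := h (lt_of_lt_of_le hR' (min_le_right _ _))
    have heq : m (z + s • W₀ - x₀) = m (z - x₀) + s * m W₀ := by
      rw [show z + s • W₀ - x₀ = (z - x₀) + s • W₀ by abel, map_add, map_smul, smul_eq_mul]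
    rw [heq] at h
    refine h.trans (mul_le_mul_of_nonneg_left ?_ hε₁.le)
    calc ‖z + s • W₀ - x₀‖ = ‖(z - x₀) + s • W₀‖ := by abel_nf
      _ ≤ ‖z - x₀‖ + ‖s • W₀‖ := norm_add_le _ _
      _ = ‖z - x₀‖ + |s| * ‖W₀‖ := by rw [norm_smul, Real.norm_eq_abs]
  have hε₁ρ : ε₁ * ‖z - x₀‖ ≤ ε * ρ :=
    calc ε₁ * ‖z - x₀‖ ≤ ε₁ * ρ := mul_le_mul_of_nonneg_left hqρ.le hε₁.le
      _ ≤ ε * ρ := mul_le_mul_of_nonneg_right hε₁ε hρ0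
  constructor
  · -- `q ∉ I⁻(Σ)`: the past line from `φ⁻¹(z - l₀ Ŵ) ∈ I⁻(Σ)` to `q` meets `Σ`
    intro hqpast
    set β : ℝ → M := (extChartAt I p).symm ∘ fun s ↦ (z - l₀ • W₀) + s • W₀ with hβdef
    have hzl : ∀ s ∈ Icc (0 : ℝ) l₀, z - l₀ • W₀ + s • W₀ = z + (s - l₀) • W₀ := fun s _ ↦ by
      rw [sub_smul]; abel
    have habs : ∀ s ∈ Icc (0 : ℝ) l₀, |s - l₀| ≤ l₀ := fun s hs ↦ by
      rw [abs_sub_comm, abs_of_nonneg (by linarith [hs.2])]; linarith [hs.1]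
    have hβ : g.IsFutureTimelikeCurveOn τ β (Icc 0 l₀) := hline _ _ fun s hs ↦ by
      rw [hzl s hs]; exact hzs _ (habs s hs)
    have hβ0 : β 0 ∉ g.chronologicalFuture τ Sig := by
      have hmem : β 0 ∈ g.chronologicalPast τ Sig := by
        simp only [hβdef, comp_apply, zero_smul, add_zero]
        apply hρb'
        rw [show z - l₀ • W₀ - (x₀ - l₀ • W₀) = z - x₀ by abel]
        exact lt_of_lt_of_le hqρ hρble
      exact fun h ↦ not_mem_chronologicalPast_of_mem_chronologicalFuture hn hSig h hmem
    have hβl : β l₀ ∉ g.chronologicalPast τ Sig := by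
      simp only [hβdef, comp_apply, sub_add_cancel, hqz]
      exact hqpast
    obtain ⟨s, hs, hsSig⟩ := exists_mem_of_isFutureTimelikeCurveOn hn hSig hl₀.le hβ hβ0 hβl
    have hmem : (extChartAt I p).symm (z + (s - l₀) • W₀) ∈ Sig := by
      have : β s = (extChartAt I p).symm (z + (s - l₀) • W₀) := by
        simp only [hβdef, comp_apply, hzl s hs]
      rwa [this] at hsSig
    have h := (le_abs_self _).trans (hTz _ (habs s hs) hmem)
    rw [abs_of_nonpos (by linarith [hs.2] : s - l₀ ≤ 0)] at h
    have hμ : 0 ≤ l₀ - s := by linarith [hs.2]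
    have h2 : (l₀ - s) * (ε₁ * ‖W₀‖ - a) ≤ 0 :=
      mul_nonpos_of_nonneg_of_nonpos hμ (by linarith)
    have h3 : m (z - x₀) ≤ ε₁ * ‖z - x₀‖ + (l₀ - s) * (ε₁ * ‖W₀‖ - a) := by
      have e1 : (s - l₀) * m W₀ = (l₀ - s) * a := by rw [hadef]; ring
      have e2 : ε₁ * (‖z - x₀‖ + -(s - l₀) * ‖W₀‖) =
          ε₁ * ‖z - x₀‖ + (l₀ - s) * (ε₁ * ‖W₀‖) := by ring
      rw [e1, e2] at h
      linarith
    linarith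
  · -- `q ∉ I⁺(Σ)`: the future line from `q` to `φ⁻¹(z + l₀ Ŵ) ∈ I⁺(Σ)` meets `Σ`
    intro hqfut
    set β : ℝ → M := (extChartAt I p).symm ∘ fun s ↦ z + s • W₀ with hβdef
    have habs : ∀ s ∈ Icc (0 : ℝ) l₀, |s| ≤ l₀ := fun s hs ↦ by
      rw [abs_of_nonneg hs.1]; exact hs.2
    have hβ : g.IsFutureTimelikeCurveOn τ β (Icc 0 l₀) := hline _ _ fun s hs ↦ hzs _ (habs s hs)
    have hβ0 : β 0 ∉ g.chronologicalFuture τ Sig := by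
      simp only [hβdef, comp_apply, zero_smul, add_zero, hqz]
      exact hqfut
    have hβl : β l₀ ∉ g.chronologicalPast τ Sig := by
      have hmem : β l₀ ∈ g.chronologicalFuture τ Sig := by
        simp only [hβdef, comp_apply]
        apply hρf'
        rw [show z + l₀ • W₀ - (x₀ + l₀ • W₀) = z - x₀ by abel]
        exact lt_of_lt_of_le hqρ hρfle
      exact not_mem_chronologicalPast_of_mem_chronologicalFuture hn hSig hmem
    obtain ⟨s, hs, hsSig⟩ := exists_mem_of_isFutureTimelikeCurveOn hn hSig hl₀.le hβ hβ0 hβl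
    have hmem : (extChartAt I p).symm (z + s • W₀) ∈ Sig := by
      simpa only [hβdef, comp_apply] using hsSig
    have h' := neg_le_of_abs_le (hTz _ (habs s hs) hmem)
    rw [abs_of_nonneg hs.1] at h'
    have h2 : 0 ≤ s * (a - ε₁ * ‖W₀‖) := mul_nonneg hs.1 (by linarith)
    have h3 : -(ε₁ * ‖z - x₀‖) + s * (a - ε₁ * ‖W₀‖) ≤ m (z - x₀) := by
      have e1 : s * m W₀ = -(s * a) := by rw [hadef]; ring
      have e2 : -(ε₁ * (‖z - x₀‖ + s * ‖W₀‖)) = -(ε₁ * ‖z - x₀‖) - s * (ε₁ * ‖W₀‖) := by ring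
      rw [e1, e2] at h'
      linarith
    linarith

end OneSided

end SubdataDevelopmentsEmbed

end Summit.FinalStateConjecture.FinalStateConjecture.Theorems

end
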